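/-
Copyright: the b2b-balaban T⁴-continuum CRUX team, row NE7b leaf lineage `t4-ne7b-formalise-leaf-04` (gen 147). Project licence.
-/
import Summits.QuantumFields.BalabanUV.T4Continuum.Spine.NE7b.FibreWindowHessian
import Summits.QuantumFields.BalabanUV.T4Continuum.Spine.NE7b.HessianFormFirstOrder
import Summits.QuantumFields.BalabanUV.T4Continuum.Spine.NE7b.ConvexWindowVarianceMajorant
import Summits.QuantumFields.BalabanUV.T4Continuum.Spine.NE7b.ConvexWindowSlabHessian
import Mathlib.Analysis.Normed.Group.Bounded

/-!
# THE HESSIAN ROAD'S FLUCTUATION STEP, SHARP FORM — junctions: `D²V⁺(x)[u,u] ≥ ⟨∂ᵤᵤV − h⟩_ν` for every admissible majorant `h`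
# (row NE7b, node U5c; import-form of the lineage's kernel certificates J-VM ∕ J-BLOCK ∕ J-JOINT — [folklore], kernel theorems)

Cell `pub-balaban`, sub-cell `t4`, spine estimate NE7b (`T4WeightBudget.RelWeightBound`; NOT PRINTED in [Bałaban 1983–89], NOT PROVED).  Crux-route work
under `Spine/NE7b/` by leaf-04; NOTHING of Bałaban's is named, valued or asserted; no `def`; zero `sorry`.  Imports FOUR row files BY NAME:
`…FibreWindowHessian` (leaf-06; Brascamp–Lieb's formula `D²V⁺ = −B∕Z + A²∕Z²`), `…HessianFormFirstOrder` (leaf-03; Hessian display ⟹ first-order letter),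
`…ConvexWindowVarianceMajorant` and `…ConvexWindowSlabHessian` (this lineage).  STAGED until all four have hub oleans; the bodies below are the glue of the
NOT-TO-FILE concat certificates `Concat2_FWH11_CWVM_JVM` dc7d0e0098d2c9cb, `Concat3_HFFO2_CWVM_CWSH11_JBLOCK` 4ecca7c15ba41af5,
`Concat4_HFFO2_FWH11_CWVM_CWSH11_JJOINT` 19514582b04120b7 (all rc 0 ∣ [] ∣ [] ∣ 0 sorry, axioms trio) with the namespaces renamed.
WHAT IS PROVED ([folklore]): §1 `hessian_negLogFibreWindowMass_ge_tiltedMean` — product window `B × F` (`F ⊆ ℝⁿ` bounded convex measurable, `volume F ≠ 0`),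
`V ∈ C²` jointly, ANY measurable majorant `h` bounded on `F` with the slab letter for `(s,y) ↦ V(x,y) + s·DV(x,y)(u,0) + (s²∕2)·h y`
⊢ `(∫_F (D²V(x,y)[(u,0),(u,0)] − h y)e^{−V(x,y)}dy) ∕ ∫_F e^{−V(x,·)} ≤ D²V⁺(x)[u,u]`; §2 `convexOn_slab_of_block` ∕ `sqIntegral_sub_sq_windowTilted_le_of_block` —
the slab letter ∕ the variance bound from a BLOCK display with slack in the letters of `W, g, h ∈ C²`; §3 `hessian_negLogFibreWindowMass_ge_of_jointBlock` —
`V ∈ C³` jointly, the JOINT block display with slack at the section through `x`, bounds ⟹ the §1 display: JOINT BLOCK HESSIAN IN ⟹ NEXT-SCALE HESSIAN LETTER OUT.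
NOT HERE (honest): which `V, F, h, δ, M` print's steps display in which chart ((A3)∕(A1c), programme-sized, NC-NE7b-α UNRULED); unbounded ∕ joint (non-product)
windows; anything of Bałaban's.  BY-NAME EFFECT ON THE WALL: NONE.  NE7b NOT PRINTED ∕ NOT PROVED; spine PROVED 0∕9; rung (B)+1 on a FINITE torus — NOT infinite
volume, NOT the mass gap, NOT Clay.  HONEST DEPENDENCY: continuum YM on T⁴ ⇐ BetaPertH ∧ nine spine estimates (0/9 proved); BetaPertH ⇐ (D1) ∧ (D4) ∧ CAP+tail;
G-an2-4 gates asym, D1 and NE2∕3∕4.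
-/

set_option autoImplicit false

noncomputable section

open MeasureTheory Real Set Filter Topology
open Summit.QuantumFields.BalabanUV.T4Continuum.NE7b

namespace Summit.QuantumFields.BalabanUV.T4Continuum.NE7b.FibreWindowHessianMajorant

/-! ## §1 The END on a product window with any admissible majorant (J-VM) -/

/-- **THE END WITH ANY ADMISSIBLE MAJORANT**: `D²V⁺(x)[u,u] ≥ (∫_F (∂ᵤᵤV(x,·) − h) e^{−V(x,·)}) ∕ ∫_F e^{−V(x,·)}` whenever `(s,y) ↦ V(x,y) + s·∂ᵤV(x,y) + (s²∕2)·h(y)` is convex on a slab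
`Ioo (−r) r ×ˢ F`. -/
theorem hessian_negLogFibreWindowMass_ge_tiltedMean {m n : ℕ} {V : (EuclideanSpace ℝ (Fin m)) × (EuclideanSpace ℝ (Fin n)) → ℝ}
    (hV : ContDiff ℝ 2 V) {F : Set (EuclideanSpace ℝ (Fin n))} (hF : MeasurableSet F) (hFb : Bornology.IsBounded F) (hF0 : volume F ≠ 0)
    (hFc : Convex ℝ F) (x u : EuclideanSpace ℝ (Fin m)) {h : EuclideanSpace ℝ (Fin n) → ℝ} (hhm : Measurable h) {H : ℝ}
    (hhb : ∀ y ∈ F, |h y| ≤ H) {r : ℝ} (hr : 0 < r)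
    (hconv : ConvexOn ℝ (Ioo (-r) r ×ˢ F) (fun p : ℝ × EuclideanSpace ℝ (Fin n) =>
      V (x, p.2) + p.1 * fderiv ℝ V (x, p.2) (u, 0) + p.1 ^ 2 / 2 * h p.2)) :
    (∫ y in F, (fderiv ℝ (fderiv ℝ V) (x, y) (u, 0) (u, 0) - h y) * exp (-V (x, y))) / (∫ y in F, exp (-V (x, y))) ≤
      iteratedFDeriv ℝ 2 (fun x => -log (∫ y in F, exp (-V (x, y)))) x ![u, u] := by
  rw [FibreWindowHessian.iteratedFDeriv_two_negLogFibreWindowMass hV hF hFb hF0 x u]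
  have hc : IsCompact (closure F) := hFb.isCompact_closure
  have hsec : Continuous fun y : EuclideanSpace ℝ (Fin n) => ((x, y) : (EuclideanSpace ℝ (Fin m)) × (EuclideanSpace ℝ (Fin n))) :=
    continuous_const.prodMk continuous_id
  have hWc : Continuous fun y => V (x, y) := hV.continuous.comp hsec
  have hgc : Continuous fun y => fderiv ℝ V (x, y) (u, 0) :=
    ((hV.continuous_fderiv (by norm_num)).comp hsec).clm_apply continuous_const
  have hbc : Continuous fun y => fderiv ℝ (fderiv ℝ V) (x, y) (u, 0) (u, 0) :=
    ((((hV.fderiv_right (m := 1) (by norm_num)).continuous_fderiv (by norm_num)).comp hsec).clm_apply continuous_const).clm_apply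
      continuous_const
  obtain ⟨CW, hCW⟩ := hc.exists_bound_of_continuousOn hWc.continuousOn
  obtain ⟨Cg, hCg⟩ := hc.exists_bound_of_continuousOn hgc.continuousOn
  obtain ⟨Cb, hCb⟩ := hc.exists_bound_of_continuousOn hbc.continuousOn
  have hWl : ∀ y ∈ F, -CW ≤ V (x, y) := fun y hy => by
    have := hCW y (subset_closure hy); rw [Real.norm_eq_abs] at this; linarith [neg_abs_le (V (x, y))]
  have hgb : ∀ y ∈ F, |fderiv ℝ V (x, y) (u, 0)| ≤ Cg := fun y hy => by simpa [Real.norm_eq_abs] using hCg y (subset_closure hy)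
  have hbb : ∀ y ∈ F, |fderiv ℝ (fderiv ℝ V) (x, y) (u, 0) (u, 0)| ≤ Cb := fun y hy => by
    simpa [Real.norm_eq_abs] using hCb y (subset_closure hy)
  exact ConvexWindowVarianceMajorant.negLogMass_hessianLetter_ge (W := fun y => V (x, y)) (g := fun y => fderiv ℝ V (x, y) (u, 0))
    (b := fun y => fderiv ℝ (fderiv ℝ V) (x, y) (u, 0) (u, 0)) (h := h) hFc hF hFb hF0 hWc.measurable hgc.measurable hhm hbc.measurable
    hWl hgb hhb hbb hr hconv

/-! ## §2 From a block display with slack in the letters of `W, g, h` (J-BLOCK) -/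

section Block

variable {n : ℕ} {K : Set (EuclideanSpace ℝ (Fin n))} {W g h : EuclideanSpace ℝ (Fin n) → ℝ} {δ M r : ℝ}


/-- Slab convexity of `(s,y) ↦ W y + s·g y + (s²∕2)·h y` on `Ioo (−r) r ×ˢ K` from the block display with slack (`W, g, h ∈ C²`; `r ≤ 1`, `4rM ≤ δ`):
`…ConvexWindowSlabHessian.slab_hessian_nonneg_of_block` ⟹ `…HessianFormFirstOrder` §1 (`Q = 0`) ⟹ `…ConvexWindowVarianceMajorant.convexOn_of_firstOrder`. [folklore] -/
theorem convexOn_slab_of_block (hK : Convex ℝ K) (hW : ContDiff ℝ 2 W) (hg : ContDiff ℝ 2 g) (hh : ContDiff ℝ 2 h)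
    (hM : 0 ≤ M) (hr1 : r ≤ 1) (hrM : 4 * r * M ≤ δ)
    (hblock : ∀ y ∈ K, ∀ (σ : ℝ) (v : EuclideanSpace ℝ (Fin n)),
      δ * (σ ^ 2 + ‖v‖ ^ 2) ≤ iteratedFDeriv ℝ 2 W y (fun _ => v) + 2 * σ * fderiv ℝ g y v + σ ^ 2 * h y)
    (hg2 : ∀ y ∈ K, ∀ v : EuclideanSpace ℝ (Fin n), |iteratedFDeriv ℝ 2 g y (fun _ => v)| ≤ M * ‖v‖ ^ 2)
    (hh1 : ∀ y ∈ K, ∀ v : EuclideanSpace ℝ (Fin n), |fderiv ℝ h y v| ≤ M * ‖v‖)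
    (hh2 : ∀ y ∈ K, ∀ v : EuclideanSpace ℝ (Fin n), |iteratedFDeriv ℝ 2 h y (fun _ => v)| ≤ M * ‖v‖ ^ 2) :
    ConvexOn ℝ (Ioo (-r) r ×ˢ K) (fun p : ℝ × EuclideanSpace ℝ (Fin n) => W p.2 + p.1 * g p.2 + p.1 ^ 2 / 2 * h p.2) := by
  have hH := ConvexWindowSlabHessian.slab_hessian_nonneg_of_block hW hg hh hM hr1 hrM hblock hg2 hh1 hh2
  have hslab : Convex ℝ (Ioo (-r) r ×ˢ K) := (convex_Ioo _ _).prod hK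
  have h1 := HessianFormFirstOrder.firstOrderOn_form_of_hessianOn_lower_fderiv hslab (ConvexWindowSlabHessian.contDiff_slab hW hg hh)
    (fun _ => (0 : ℝ)) (fun p hp w => by
      have := hH p hp w
      have e : (fun _ : Fin 2 => w) = ![w, w] := by funext i; fin_cases i <;> rfl
      rw [e] at this
      simpa using this)
  refine ConvexWindowVarianceMajorant.convexOn_of_firstOrder hslab
    (fun p => ((fderiv ℝ (fun p : ℝ × EuclideanSpace ℝ (Fin n) => W p.2 + p.1 * g p.2 + p.1 ^ 2 / 2 * h p.2) p :
      (ℝ × EuclideanSpace ℝ (Fin n)) →L[ℝ] ℝ) : (ℝ × EuclideanSpace ℝ (Fin n)) →ₗ[ℝ] ℝ)) fun p hp q hq => ?_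
  simpa using h1 p hp q hq

/-- **BLOCK DISPLAY IN ⟹ VARIANCE BOUND OUT**: `K` convex, measurable, bounded, `volume K ≠ 0`; `W, g, h ∈ C²`; block display with slack `δ` on `K`; bounds `M` on `D²g, Dh, D²h` over `K`;
`0 < r ≤ 1`, `4rM ≤ δ` ⊢ `∫ g² dν_{W,K} − (∫ g dν_{W,K})² ≤ ∫ h dν_{W,K}`. -/
theorem sqIntegral_sub_sq_windowTilted_le_of_block (hK : Convex ℝ K) (hKm : MeasurableSet K) (hKb : Bornology.IsBounded K) (hK0 : volume K ≠ 0)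
    (hW : ContDiff ℝ 2 W) (hg : ContDiff ℝ 2 g) (hh : ContDiff ℝ 2 h) (hM : 0 ≤ M) (hr : 0 < r) (hr1 : r ≤ 1) (hrM : 4 * r * M ≤ δ)
    (hblock : ∀ y ∈ K, ∀ (σ : ℝ) (v : EuclideanSpace ℝ (Fin n)),
      δ * (σ ^ 2 + ‖v‖ ^ 2) ≤ iteratedFDeriv ℝ 2 W y (fun _ => v) + 2 * σ * fderiv ℝ g y v + σ ^ 2 * h y)
    (hg2 : ∀ y ∈ K, ∀ v : EuclideanSpace ℝ (Fin n), |iteratedFDeriv ℝ 2 g y (fun _ => v)| ≤ M * ‖v‖ ^ 2)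
    (hh1 : ∀ y ∈ K, ∀ v : EuclideanSpace ℝ (Fin n), |fderiv ℝ h y v| ≤ M * ‖v‖)
    (hh2 : ∀ y ∈ K, ∀ v : EuclideanSpace ℝ (Fin n), |iteratedFDeriv ℝ 2 h y (fun _ => v)| ≤ M * ‖v‖ ^ 2) :
    ∫ y, g y ^ 2 ∂((volume.restrict K).tilted fun y => -W y) - (∫ y, g y ∂((volume.restrict K).tilted fun y => -W y)) ^ 2 ≤
      ∫ y, h y ∂((volume.restrict K).tilted fun y => -W y) := by
  have hc : IsCompact (closure K) := hKb.isCompact_closure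
  obtain ⟨CW, hCW⟩ := hc.exists_bound_of_continuousOn hW.continuous.continuousOn
  obtain ⟨Cg, hCg⟩ := hc.exists_bound_of_continuousOn hg.continuous.continuousOn
  obtain ⟨Ch, hCh⟩ := hc.exists_bound_of_continuousOn hh.continuous.continuousOn
  have hWl : ∀ y ∈ K, -CW ≤ W y := fun y hy => by
    have := hCW y (subset_closure hy); rw [Real.norm_eq_abs] at this; linarith [neg_abs_le (W y)]
  have hgb : ∀ y ∈ K, |g y| ≤ Cg := fun y hy => by simpa [Real.norm_eq_abs] using hCg y (subset_closure hy)
  have hhb : ∀ y ∈ K, |h y| ≤ Ch := fun y hy => by simpa [Real.norm_eq_abs] using hCh y (subset_closure hy)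
  exact ConvexWindowVarianceMajorant.sqIntegral_sub_sq_windowTilted_le_of_convexOn hK hKm hKb hK0 hW.continuous.measurable
    hg.continuous.measurable hh.continuous.measurable hWl hgb hhb hr (convexOn_slab_of_block hK hW hg hh hM hr1 hrM hblock hg2 hh1 hh2)

end Block

/-! ## §3 From a JOINT block display of a `C³` exponent (J-JOINT) -/

/-- **JOINT BLOCK HESSIAN IN ⟹ NEXT-SCALE HESSIAN LETTER OUT**: `V : ℝᵐ × ℝⁿ → ℝ` jointly `C³`; `F ⊆ ℝⁿ` measurable, bounded, convex, `volume F ≠ 0`;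
a `C²` majorant `h`; `0 ≤ M`, `0 < r ≤ 1`, `4rM ≤ δ`; the JOINT block display with slack at the section through `x`
(`δ(σ² + ‖v‖²) ≤ D²V(x,y)[(0,v),(0,v)] + 2σ·D²V(x,y)[(0,v),(u,0)] + σ²·h y` on `F`) and the bounds `|D²(∂ᵤV(x,·))[v,v]|, |D²h[v,v]| ≤ M‖v‖²`,
`|Dh v| ≤ M‖v‖` on `F` ⊢ `(∫_F (D²V(x,y)[(u,0),(u,0)] − h y)e^{−V(x,y)}dy) ∕ ∫_F e^{−V(x,·)} ≤ D²V⁺(x)[u,u]`. [folklore] -/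
theorem hessian_negLogFibreWindowMass_ge_of_jointBlock {m n : ℕ} {V : (EuclideanSpace ℝ (Fin m)) × (EuclideanSpace ℝ (Fin n)) → ℝ}
    (hV : ContDiff ℝ 3 V) {F : Set (EuclideanSpace ℝ (Fin n))} (hF : MeasurableSet F) (hFb : Bornology.IsBounded F) (hF0 : volume F ≠ 0)
    (hFc : Convex ℝ F) (x u : EuclideanSpace ℝ (Fin m)) {h : EuclideanSpace ℝ (Fin n) → ℝ} (hh : ContDiff ℝ 2 h) {δ M r : ℝ}
    (hM : 0 ≤ M) (hr : 0 < r) (hr1 : r ≤ 1) (hrM : 4 * r * M ≤ δ)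
    (hblock : ∀ y ∈ F, ∀ (σ : ℝ) (v : EuclideanSpace ℝ (Fin n)),
      δ * (σ ^ 2 + ‖v‖ ^ 2) ≤ iteratedFDeriv ℝ 2 V (x, y) (fun _ => ((0 : EuclideanSpace ℝ (Fin m)), v)) +
        2 * σ * iteratedFDeriv ℝ 2 V (x, y) ![((0 : EuclideanSpace ℝ (Fin m)), v), (u, (0 : EuclideanSpace ℝ (Fin n)))] + σ ^ 2 * h y)
    (hg2 : ∀ y ∈ F, ∀ v : EuclideanSpace ℝ (Fin n), |iteratedFDeriv ℝ 2 (fun y => fderiv ℝ V (x, y) (u, 0)) y (fun _ => v)| ≤ M * ‖v‖ ^ 2)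
    (hh1 : ∀ y ∈ F, ∀ v : EuclideanSpace ℝ (Fin n), |fderiv ℝ h y v| ≤ M * ‖v‖)
    (hh2 : ∀ y ∈ F, ∀ v : EuclideanSpace ℝ (Fin n), |iteratedFDeriv ℝ 2 h y (fun _ => v)| ≤ M * ‖v‖ ^ 2) :
    (∫ y in F, (fderiv ℝ (fderiv ℝ V) (x, y) (u, 0) (u, 0) - h y) * exp (-V (x, y))) / (∫ y in F, exp (-V (x, y))) ≤
      iteratedFDeriv ℝ 2 (fun x => -log (∫ y in F, exp (-V (x, y)))) x ![u, u] := by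
  have hV2 : ContDiff ℝ 2 V := hV.of_le (by norm_num)
  have hW : ContDiff ℝ 2 (fun y => V (x, y)) := ConvexWindowSlabHessian.contDiff_fibreSection hV2 x
  have hg : ContDiff ℝ 2 (fun y => fderiv ℝ V (x, y) (u, 0)) := ConvexWindowSlabHessian.contDiff_two_baseDerivSection hV x u
  -- the block display in the letters of the sections
  have hblock' : ∀ y ∈ F, ∀ (σ : ℝ) (v : EuclideanSpace ℝ (Fin n)),
      δ * (σ ^ 2 + ‖v‖ ^ 2) ≤ iteratedFDeriv ℝ 2 (fun y => V (x, y)) y (fun _ => v) +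
        2 * σ * fderiv ℝ (fun y => fderiv ℝ V (x, y) (u, 0)) y v + σ ^ 2 * h y := fun y hy σ v => by
    rw [ConvexWindowSlabHessian.iteratedFDeriv_two_fibreSection hV2, ConvexWindowSlabHessian.fderiv_baseDerivSection hV2]
    exact hblock y hy σ v
  have hconv := convexOn_slab_of_block hFc hW hg hh hM hr1 hrM hblock' hg2 hh1 hh2
  -- the END through J-VM's route (FWH §6 + CWVM §5), bounds from continuity on the compact closure
  have hc : IsCompact (closure F) := hFb.isCompact_closure
  obtain ⟨Ch, hCh⟩ := hc.exists_bound_of_continuousOn hh.continuous.continuousOn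
  have hhb : ∀ y ∈ F, |h y| ≤ Ch := fun y hy => by simpa [Real.norm_eq_abs] using hCh y (subset_closure hy)
  rw [FibreWindowHessian.iteratedFDeriv_two_negLogFibreWindowMass hV2 hF hFb hF0 x u]
  have hsec : Continuous fun y : EuclideanSpace ℝ (Fin n) => ((x, y) : (EuclideanSpace ℝ (Fin m)) × (EuclideanSpace ℝ (Fin n))) :=
    continuous_const.prodMk continuous_id
  have hbc : Continuous fun y => fderiv ℝ (fderiv ℝ V) (x, y) (u, 0) (u, 0) :=
    ((((hV2.fderiv_right (m := 1) (by norm_num)).continuous_fderiv (by norm_num)).comp hsec).clm_apply continuous_const).clm_apply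
      continuous_const
  obtain ⟨CW, hCW⟩ := hc.exists_bound_of_continuousOn hW.continuous.continuousOn
  obtain ⟨Cg, hCg⟩ := hc.exists_bound_of_continuousOn hg.continuous.continuousOn
  obtain ⟨Cb, hCb⟩ := hc.exists_bound_of_continuousOn hbc.continuousOn
  have hWl : ∀ y ∈ F, -CW ≤ V (x, y) := fun y hy => by
    have := hCW y (subset_closure hy); rw [Real.norm_eq_abs] at this; linarith [neg_abs_le (V (x, y))]
  have hgb : ∀ y ∈ F, |fderiv ℝ V (x, y) (u, 0)| ≤ Cg := fun y hy => by simpa [Real.norm_eq_abs] using hCg y (subset_closure hy)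
  have hbb : ∀ y ∈ F, |fderiv ℝ (fderiv ℝ V) (x, y) (u, 0) (u, 0)| ≤ Cb := fun y hy => by
    simpa [Real.norm_eq_abs] using hCb y (subset_closure hy)
  exact ConvexWindowVarianceMajorant.negLogMass_hessianLetter_ge (W := fun y => V (x, y)) (g := fun y => fderiv ℝ V (x, y) (u, 0))
    (b := fun y => fderiv ℝ (fderiv ℝ V) (x, y) (u, 0) (u, 0)) (h := h) hFc hF hFb hF0 hW.continuous.measurable hg.continuous.measurable
    hh.continuous.measurable hbc.measurable hWl hgb hhb hbb hr hconv

end Summit.QuantumFields.BalabanUV.T4Continuum.NE7b.FibreWindowHessianMajorant
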